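import Mathlib.Topology.Order.IntermediateValue
import Mathlib.Topology.Homeomorph.Lemmas
import Mathlib.Order.CompleteLatticeIntervals
import Mathlib.Topology.Instances.Real.Lemmas
import Mathlib.Algebra.BigOperators.Group.Finset.Basic

/-!
# `RealOnePeriodRelations` (stmt-KontsevichZagierPeriods-10042) — negative side: the Euler
# characteristic of a tame subset of `ℝ`

Pure order topology, used by `Negative/EulerCharacteristic` to show that RULE 1a (domain
additivity) is load-bearing in the crux. For `s ⊆ ℝ` with finitely many connected components
(every `ℚ`-semialgebraic subset of `ℝ¹` is such) we define the o-minimal EULER CHARACTERISTIC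
`eulerChar s = Σ_K endWeight K` over the components `K` (intervals), where
`endWeight K = [K has a least element] + [K has a greatest element] − 1`
(`−1` for open intervals, `0` for half-open ones, `1` for points and closed bounded intervals), and
prove here the combinatorial heart (this file; the sequel `Negative/IntervalEulerInvariance` has
additivity of `eulerChar` over arbitrary finite decompositions and its invariance under continuous
injections):

* `lt_or_gt_of_disjoint`, `exists_last` — disjoint intervals are linearly ordered;
* the JUNCTION lemmas — gluing a final interval onto an order-connected set closes exactly one end
  (`exists_isGreatest_iff_not_exists_isLeast`), so `endWeight` adds (`endWeight_eq_add_of_union_lt`);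
* `endWeight_eq_sum` — the end weight of ONE interval is the sum of the weights of the pieces of any
  finite decomposition into disjoint non-empty order-connected pieces (induction on the last piece).

[van den Dries, *Tame topology and o-minimal structures* (1998), Ch. 4 §2; folklore in dimension 1]
-/

noncomputable section

open Set

namespace Summit.KontsevichZagierPeriods.SymplecticScissors.RealOnePeriodRelationsNegative

/-! ## §1 Weights of intervals -/

open scoped Classical in
/-- `leftWeight K = 1` if `K` has a least element, else `0`. [folklore] -/
def leftWeight (K : Set ℝ) : ℤ := if ∃ a, IsLeast K a then 1 else 0

open scoped Classical in
/-- `rightWeight K = 1` if `K` has a greatest element, else `0`. [folklore] -/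
def rightWeight (K : Set ℝ) : ℤ := if ∃ b, IsGreatest K b then 1 else 0

/-- The END WEIGHT of a set of reals: `[has a least element] + [has a greatest element] − 1`.
On a non-empty interval this is its compactly supported Euler characteristic. [folklore] -/
def endWeight (K : Set ℝ) : ℤ := leftWeight K + rightWeight K - 1

/-- The connected components of a set of reals, as a set of sets. [folklore] -/
def comps (s : Set ℝ) : Set (Set ℝ) := {K | ∃ x ∈ s, K = connectedComponentIn s x}

open scoped Classical in
/-- The EULER CHARACTERISTIC of a set of reals with finitely many connected components: the sum
of the end weights of its components (junk value `0` if there are infinitely many). [folklore] -/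
def eulerChar (s : Set ℝ) : ℤ :=
  if h : (comps s).Finite then ∑ K ∈ h.toFinset, endWeight K else 0

/-- `leftWeight` only depends on whether a least element exists. [folklore] -/
theorem leftWeight_congr {K K' : Set ℝ} (h : (∃ a, IsLeast K a) ↔ ∃ a, IsLeast K' a) :
    leftWeight K = leftWeight K' := by
  unfold leftWeight
  by_cases h1 : ∃ a, IsLeast K a
  · rw [if_pos h1, if_pos (h.1 h1)]
  · rw [if_neg h1, if_neg fun h2 => h1 (h.2 h2)]

/-- `rightWeight` only depends on whether a greatest element exists. [folklore] -/
theorem rightWeight_congr {K K' : Set ℝ} (h : (∃ b, IsGreatest K b) ↔ ∃ b, IsGreatest K' b) :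
    rightWeight K = rightWeight K' := by
  unfold rightWeight
  by_cases h1 : ∃ b, IsGreatest K b
  · rw [if_pos h1, if_pos (h.1 h1)]
  · rw [if_neg h1, if_neg fun h2 => h1 (h.2 h2)]

/-- Exchange of ends: a least element on one side, a greatest element on the other. [folklore] -/
theorem leftWeight_eq_rightWeight {K K' : Set ℝ} (h : (∃ a, IsLeast K a) ↔ ∃ b, IsGreatest K' b) :
    leftWeight K = rightWeight K' := by
  unfold leftWeight rightWeight
  by_cases h1 : ∃ a, IsLeast K a
  · rw [if_pos h1, if_pos (h.1 h1)]
  · rw [if_neg h1, if_neg fun h2 => h1 (h.2 h2)]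

/-- An open interval (or the empty set) has end weight `−1`. [folklore] -/
theorem endWeight_Ioo (a b : ℝ) : endWeight (Ioo a b) = -1 := by
  have h1 : ¬ ∃ m, IsLeast (Ioo a b) m := by
    rintro ⟨m, hm, hle⟩
    have hmid : (a + m) / 2 ∈ Ioo a b := ⟨by linarith [hm.1, hm.2], by linarith [hm.1, hm.2]⟩
    have := hle hmid
    linarith [hm.1, hm.2]
  have h2 : ¬ ∃ m, IsGreatest (Ioo a b) m := by
    rintro ⟨m, hm, hge⟩
    have hmid : (m + b) / 2 ∈ Ioo a b := ⟨by linarith [hm.1, hm.2], by linarith [hm.1, hm.2]⟩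
    have := hge hmid
    linarith [hm.1, hm.2]
  unfold endWeight leftWeight rightWeight
  rw [if_neg h1, if_neg h2]
  norm_num

/-! ## §2 Components -/

/-- The component of a point of `s` is a component. [folklore] -/
theorem mem_comps_of_mem {s : Set ℝ} {x : ℝ} (hx : x ∈ s) : connectedComponentIn s x ∈ comps s :=
  ⟨x, hx, rfl⟩

/-- Components are subsets. [folklore] -/
theorem comps_subset {s K : Set ℝ} (hK : K ∈ comps s) : K ⊆ s := by
  obtain ⟨x, -, rfl⟩ := hK
  exact connectedComponentIn_subset _ _

/-- Components are non-empty. [folklore] -/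
theorem comps_nonempty {s K : Set ℝ} (hK : K ∈ comps s) : K.Nonempty := by
  obtain ⟨x, hx, rfl⟩ := hK
  exact ⟨x, mem_connectedComponentIn hx⟩

/-- Components of a set of reals are order-connected (intervals). [folklore] -/
theorem comps_ordConnected {s K : Set ℝ} (hK : K ∈ comps s) : OrdConnected K := by
  obtain ⟨x, -, rfl⟩ := hK
  exact isPreconnected_iff_ordConnected.1 isPreconnected_connectedComponentIn

/-- A component is the component of each of its points. [folklore] -/
theorem comps_eq_of_mem {s K : Set ℝ} (hK : K ∈ comps s) {y : ℝ} (hy : y ∈ K) :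
    K = connectedComponentIn s y := by
  obtain ⟨x, -, rfl⟩ := hK
  exact connectedComponentIn_eq hy

/-- Distinct components are disjoint. [folklore] -/
theorem comps_disjoint {s K K' : Set ℝ} (hK : K ∈ comps s) (hK' : K' ∈ comps s) (h : K ≠ K') :
    Disjoint K K' := by
  rw [Set.disjoint_iff]
  rintro z ⟨hz, hz'⟩
  exact h ((comps_eq_of_mem hK hz).trans (comps_eq_of_mem hK' hz').symm)

/-- The components cover. [folklore] -/
theorem sUnion_comps (s : Set ℝ) : ⋃₀ comps s = s := by
  apply Subset.antisymm
  · rintro z ⟨K, hK, hz⟩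
    exact comps_subset hK hz
  · intro z hz
    exact ⟨_, mem_comps_of_mem hz, mem_connectedComponentIn hz⟩

/-- A non-empty preconnected subset of `s` lies in exactly one component: the one of any of its
points. [folklore] -/
theorem subset_comps_iff {s I K : Set ℝ} (hI : IsPreconnected I) (hIs : I ⊆ s) {x : ℝ} (hx : x ∈ I)
    (hK : K ∈ comps s) : I ⊆ K ↔ K = connectedComponentIn s x := by
  constructor
  · intro h
    exact comps_eq_of_mem hK (h hx)
  · rintro rfl
    exact hI.subset_connectedComponentIn hx hIs

/-! ## §3 Order lemmas on disjoint intervals -/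

/-- Two disjoint non-empty order-connected sets of reals are comparable: one lies entirely to the
left of the other. [folklore] -/
theorem lt_or_gt_of_disjoint {I J : Set ℝ} (hI : OrdConnected I) (hJ : OrdConnected J)
    (hIne : I.Nonempty) (hJne : J.Nonempty) (hd : Disjoint I J) :
    (∀ a ∈ I, ∀ b ∈ J, a < b) ∨ (∀ a ∈ I, ∀ b ∈ J, b < a) := by
  obtain ⟨a₀, ha₀⟩ := hIne
  obtain ⟨b₀, hb₀⟩ := hJne
  have hne : a₀ ≠ b₀ := fun h => Set.disjoint_left.1 hd ha₀ (h ▸ hb₀)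
  rcases lt_or_gt_of_ne hne with hlt | hgt
  · left
    intro a ha b hb
    by_contra! hba
    rcases le_or_gt a₀ b with h1 | h1
    · exact Set.disjoint_left.1 hd (hI.out ha₀ ha ⟨h1, hba⟩) hb
    · exact Set.disjoint_left.1 hd ha₀ (hJ.out hb hb₀ ⟨h1.le, hlt.le⟩)
  · right
    intro a ha b hb
    by_contra! hab
    rcases le_or_gt b₀ a with h1 | h1
    · exact Set.disjoint_left.1 hd ha (hJ.out hb₀ hb ⟨h1, hab⟩)
    · exact Set.disjoint_left.1 hd (hI.out ha ha₀ ⟨h1.le, hgt.le⟩) hb₀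

section Junction

variable {C C' L : Set ℝ}

/-- Junction, part (a): removing a final interval from an order-connected set leaves an
order-connected set. [folklore] -/
theorem ordConnected_of_union_lt (hC : OrdConnected C) (hCU : C = C' ∪ L)
    (hlt : ∀ a ∈ C', ∀ b ∈ L, a < b) : OrdConnected C' := by
  refine ⟨fun x hx y hy z hz => ?_⟩
  have hzC : z ∈ C := hC.out (hCU ▸ Or.inl hx) (hCU ▸ Or.inl hy) hz
  rw [hCU] at hzC
  rcases hzC with h | h
  · exact h
  · exact absurd (hlt y hy z h) (not_lt.2 hz.2)

/-- Junction, part (b): the least element lives in the initial part. [folklore] -/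
theorem exists_isLeast_iff_of_union_lt (hCU : C = C' ∪ L) (hC'ne : C'.Nonempty)
    (hlt : ∀ a ∈ C', ∀ b ∈ L, a < b) :
    (∃ a, IsLeast C a) ↔ ∃ a, IsLeast C' a := by
  constructor
  · rintro ⟨a, haC, ha⟩
    rw [hCU] at haC ha
    rcases haC with haC' | haL
    · exact ⟨a, haC', fun x hx => ha (Or.inl hx)⟩
    · obtain ⟨c, hc⟩ := hC'ne
      exact absurd (ha (Or.inl hc)) (not_le.2 (hlt c hc a haL))
  · rintro ⟨a, haC', ha⟩
    refine ⟨a, hCU ▸ Or.inl haC', fun x hx => ?_⟩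
    rw [hCU] at hx
    rcases hx with hx | hx
    · exact ha hx
    · exact (hlt a haC' x hx).le

/-- Junction, part (c): the greatest element lives in the final part. [folklore] -/
theorem exists_isGreatest_iff_of_union_lt (hCU : C = C' ∪ L) (hLne : L.Nonempty)
    (hlt : ∀ a ∈ C', ∀ b ∈ L, a < b) :
    (∃ b, IsGreatest C b) ↔ ∃ b, IsGreatest L b := by
  constructor
  · rintro ⟨b, hbC, hb⟩
    rw [hCU] at hbC hb
    rcases hbC with hbC' | hbL
    · obtain ⟨l, hl⟩ := hLne
      exact absurd (hb (Or.inr hl)) (not_le.2 (hlt b hbC' l hl))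
    · exact ⟨b, hbL, fun x hx => hb (Or.inr hx)⟩
  · rintro ⟨b, hbL, hb⟩
    refine ⟨b, hCU ▸ Or.inr hbL, fun x hx => ?_⟩
    rw [hCU] at hx
    rcases hx with hx | hx
    · exact (hlt x hx b hbL).le
    · exact hb hx

/-- Junction, part (d): across the junction of an order-connected set exactly one end is closed —
the initial part has a greatest element iff the final part has no least element. [folklore] -/
theorem exists_isGreatest_iff_not_exists_isLeast (hC : OrdConnected C) (hCU : C = C' ∪ L)
    (hC'ne : C'.Nonempty) (hLne : L.Nonempty) (hlt : ∀ a ∈ C', ∀ b ∈ L, a < b) :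
    (∃ b, IsGreatest C' b) ↔ ¬ ∃ a, IsLeast L a := by
  obtain ⟨l₀, hl₀⟩ := hLne
  have hbdd : BddAbove C' := ⟨l₀, fun a ha => (hlt a ha l₀ hl₀).le⟩
  have hy_ge : ∀ a ∈ C', a ≤ sSup C' := fun a ha => le_csSup hbdd ha
  have hy_le : ∀ b ∈ L, sSup C' ≤ b := fun b hb => csSup_le hC'ne fun a ha => (hlt a ha b hb).le
  have hyC : sSup C' ∈ C := by
    obtain ⟨a, ha⟩ := hC'ne
    exact hC.out (hCU ▸ Or.inl ha) (hCU ▸ Or.inr hl₀) ⟨hy_ge a ha, hy_le l₀ hl₀⟩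
  rw [hCU] at hyC
  constructor
  · rintro ⟨g, hgC', hg⟩ ⟨m, hmL, hm⟩
    have hgm : g < m := hlt g hgC' m hmL
    have hz1 : g < (g + m) / 2 := by linarith
    have hz2 : (g + m) / 2 < m := by linarith
    have hzC : (g + m) / 2 ∈ C := hC.out (hCU ▸ Or.inl hgC') (hCU ▸ Or.inr hmL) ⟨hz1.le, hz2.le⟩
    rw [hCU] at hzC
    rcases hzC with h | h
    · exact absurd (hg h) (not_le.2 hz1)
    · exact absurd (hm h) (not_le.2 hz2)
  · intro hno
    rcases hyC with hyC' | hyL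
    · exact ⟨sSup C', hyC', hy_ge⟩
    · exact absurd ⟨sSup C', hyL, hy_le⟩ hno

/-- Junction: the end weight is additive across the junction of an order-connected set.
[folklore] -/
theorem endWeight_eq_add_of_union_lt (hC : OrdConnected C) (hCU : C = C' ∪ L)
    (hC'ne : C'.Nonempty) (hLne : L.Nonempty) (hlt : ∀ a ∈ C', ∀ b ∈ L, a < b) :
    endWeight C = endWeight C' + endWeight L := by
  have h1 := exists_isLeast_iff_of_union_lt hCU hC'ne hlt
  have h2 := exists_isGreatest_iff_of_union_lt hCU hLne hlt
  have h3 := exists_isGreatest_iff_not_exists_isLeast hC hCU hC'ne hLne hlt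
  have hj : rightWeight C' + leftWeight L = 1 := by
    unfold rightWeight leftWeight
    by_cases hL : ∃ a, IsLeast L a
    · rw [if_pos hL, if_neg fun h => h3.1 h hL]
      norm_num
    · rw [if_neg hL, if_pos (h3.2 hL)]
      norm_num
  unfold endWeight
  rw [leftWeight_congr h1, rightWeight_congr h2]
  linarith

end Junction

/-! ## §4 Additivity of the end weight over a finite decomposition of one interval -/

/-- A finite non-empty family of pairwise disjoint non-empty order-connected sets of reals has a
LAST member (every other member lies to its left). [folklore] -/
theorem exists_last (P : Finset (Set ℝ)) (hPne : P.Nonempty)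
    (hoc : ∀ I ∈ P, OrdConnected I) (hne : ∀ I ∈ P, I.Nonempty)
    (hdisj : ∀ I ∈ P, ∀ J ∈ P, I ≠ J → Disjoint I J) :
    ∃ L ∈ P, ∀ I ∈ P, I ≠ L → ∀ a ∈ I, ∀ b ∈ L, a < b := by
  classical
  let p : Set ℝ → ℝ := fun I => if h : I.Nonempty then h.some else 0
  have hp : ∀ I ∈ P, p I ∈ I := fun I hI => by
    simp only [p, dif_pos (hne I hI)]
    exact (hne I hI).some_mem
  obtain ⟨L, hL, hmax⟩ := P.exists_max_image p hPne
  refine ⟨L, hL, fun I hI hIL a ha b hb => ?_⟩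
  rcases lt_or_gt_of_disjoint (hoc I hI) (hoc L hL) (hne I hI) (hne L hL) (hdisj I hI L hL hIL)
    with h | h
  · exact h a ha b hb
  · exact absurd (hmax I hI) (not_le.2 (h _ (hp I hI) _ (hp L hL)))

/-- ADDITIVITY ON ONE INTERVAL: if a non-empty order-connected `C ⊆ ℝ` is the disjoint union of a
finite family of non-empty order-connected pieces, `endWeight C` is the sum of the weights of the
pieces. [folklore] -/
theorem endWeight_eq_sum : ∀ (k : ℕ) (P : Finset (Set ℝ)) (C : Set ℝ), P.card = k →
    OrdConnected C → C.Nonempty → (∀ I ∈ P, OrdConnected I) → (∀ I ∈ P, I.Nonempty) →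
    (∀ I ∈ P, ∀ J ∈ P, I ≠ J → Disjoint I J) → ⋃₀ (P : Set (Set ℝ)) = C →
    endWeight C = ∑ I ∈ P, endWeight I := by
  classical
  intro k
  induction k with
  | zero =>
    intro P C hk _ hCne _ _ _ hU
    rw [Finset.card_eq_zero] at hk
    subst hk
    simp only [Finset.coe_empty, sUnion_empty] at hU
    exact absurd (hU ▸ hCne) Set.not_nonempty_empty
  | succ k ih =>
    intro P C hk hC hCne hoc hne hdisj hU
    have hPne : P.Nonempty := Finset.card_pos.1 (by omega)
    obtain ⟨L, hL, hlast⟩ := exists_last P hPne hoc hne hdisj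
    have hcard : (P.erase L).card = k := by rw [Finset.card_erase_of_mem hL]; omega
    have hmemP' : ∀ I ∈ P.erase L, I ∈ P ∧ I ≠ L := fun I hI => by
      rw [Finset.mem_erase] at hI; exact ⟨hI.2, hI.1⟩
    have hCU : C = ⋃₀ ((P.erase L : Finset (Set ℝ)) : Set (Set ℝ)) ∪ L := by
      rw [← hU]
      apply Subset.antisymm
      · rintro z ⟨I, hI, hz⟩
        by_cases hIL : I = L
        · exact Or.inr (hIL ▸ hz)
        · exact Or.inl ⟨I, by rw [Finset.mem_coe, Finset.mem_erase]; exact ⟨hIL, hI⟩, hz⟩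
      · rintro z (⟨I, hI, hz⟩ | hz)
        · exact ⟨I, (hmemP' I hI).1, hz⟩
        · exact ⟨L, hL, hz⟩
    have hlt : ∀ a ∈ ⋃₀ ((P.erase L : Finset (Set ℝ)) : Set (Set ℝ)), ∀ b ∈ L, a < b := by
      rintro a ⟨I, hI, ha⟩ b hb
      exact hlast I (hmemP' I hI).1 (hmemP' I hI).2 a ha b hb
    rw [← Finset.sum_erase_add _ _ hL]
    by_cases hP'e : P.erase L = ∅
    · have hC'e : ⋃₀ ((P.erase L : Finset (Set ℝ)) : Set (Set ℝ)) = ∅ := by rw [hP'e]; simp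
      rw [hP'e, Finset.sum_empty, zero_add, hCU, hC'e, empty_union]
    · have hC'ne : (⋃₀ ((P.erase L : Finset (Set ℝ)) : Set (Set ℝ))).Nonempty := by
        obtain ⟨I, hI⟩ := Finset.nonempty_iff_ne_empty.2 hP'e
        obtain ⟨z, hz⟩ := hne I (hmemP' I hI).1
        exact ⟨z, I, hI, hz⟩
      have hC'oc := ordConnected_of_union_lt hC hCU hlt
      rw [endWeight_eq_add_of_union_lt hC hCU hC'ne (hne L hL) hlt,
        ih (P.erase L) _ hcard hC'oc hC'ne (fun I hI => hoc I (hmemP' I hI).1)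
          (fun I hI => hne I (hmemP' I hI).1)
          (fun I hI J hJ hIJ => hdisj I (hmemP' I hI).1 J (hmemP' J hJ).1 hIJ) rfl]

end Summit.KontsevichZagierPeriods.SymplecticScissors.RealOnePeriodRelationsNegative

end
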